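import Mathlib
import Summits.Ventures.DiscreteObjects.Mahler.TaylorJet

/-!
# Taylor jets at the origin: products, rotations and rotation averages (venture `DiscreteObjects`, target L)

Cell `pub-namedobj`, seat `pub-namedobj-mahler` (gen 8). Framing: lottery ticket; floor = certified
bounds/negative ranges.

Continuation of `TaylorJet.lean` (infrastructure for the in-tree proof of Smyth's theorem,
[McKee–Smyth, *Around the Unit Circle*, Thm 12.1]):

* `jetPoly F N` — the Taylor polynomial of order `< N`; `eval_eq_sum_range_add_pow_mul` splits the
  evaluation of any complex polynomial at order `N`;
* `jetCoeff_mul` — the Cauchy product rule for Taylor coefficients of a product of two functions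
  holomorphic on a disc; `jetCoeff_pow_mul` — multiplication by `z^k` shifts coefficients;
* `jetCoeff_comp_mul_left` — coefficients of `z ↦ F(ω z)` (`‖ω‖ = 1`) are `ωⁿ · jetCoeff F n`;
* `jetCoeff_rotAvg` — the rotation average `z ↦ k⁻¹ Σ_{j<k} F(ωʲ z)` over the `k`-th roots of unity keeps
  exactly the coefficients of index divisible by `k` ([McKee–Smyth, Prop. 12.7]).
-/

namespace Summit.Ventures.DiscreteObjects.Mahler

open Polynomial Metric Filter Topology Asymptotics Finset

noncomputable section

/-! ### Locality -/

/-- Taylor coefficients only depend on the function on the disc: if `F'` agrees with a function `F`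
holomorphic on `ball 0 r` there, then their coefficients agree. -/
theorem jetCoeff_congr {r : ℝ} (hr : 0 < r) {F F' : ℂ → ℂ} (hF : DifferentiableOn ℂ F (ball 0 r))
    (h : ∀ z ∈ ball (0 : ℂ) r, F' z = F z) (n : ℕ) : jetCoeff F' n = jetCoeff F n :=
  jetCoeff_unique' hr (F := F') (hF.congr h) (continuousAt_jetTail hr hF (n + 1))
    (fun z hz => by rw [h z hz]; exact jet_eq F (n + 1) z) n (Nat.lt_add_one n)

/-! ### Products -/

/-- The Taylor polynomial of order `< N`. -/
def jetPoly (F : ℂ → ℂ) (N : ℕ) : ℂ[X] := ∑ n ∈ range N, C (jetCoeff F n) * X ^ n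

/-- Coefficients of the Taylor polynomial. -/
theorem coeff_jetPoly (F : ℂ → ℂ) (N n : ℕ) :
    (jetPoly F N).coeff n = if n < N then jetCoeff F n else 0 := by
  rw [jetPoly, finsetSum_coeff]
  simp only [coeff_C_mul_X_pow]
  split_ifs with h
  · rw [Finset.sum_eq_single_of_mem n (Finset.mem_range.mpr h)]
    · simp
    · intro m _ hm; simp [Ne.symm hm]
  · apply Finset.sum_eq_zero
    intro m hm
    have : n ≠ m := by intro e; subst e; exact h (Finset.mem_range.mp hm)
    simp [this]

/-- Evaluation of the Taylor polynomial. -/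
theorem eval_jetPoly (F : ℂ → ℂ) (N : ℕ) (z : ℂ) :
    (jetPoly F N).eval z = ∑ n ∈ range N, jetCoeff F n * z ^ n := by
  simp [jetPoly, eval_finsetSum]

/-- The Taylor polynomial of order `< N` has degree `< N`. -/
theorem degree_jetPoly_lt (F : ℂ → ℂ) (N : ℕ) : (jetPoly F N).degree < N := by
  rw [degree_lt_iff_coeff_zero]
  intro m hm
  rw [coeff_jetPoly, if_neg (by omega)]

/-- Evaluation of a complex polynomial split at order `N`:
`R(z) = Σ_{n<N} R.coeff n zⁿ + z^N · (R /ₘ X^N)(z)`. -/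
theorem eval_eq_sum_range_add_pow_mul (R : ℂ[X]) (N : ℕ) (z : ℂ) :
    R.eval z = (∑ n ∈ range N, R.coeff n * z ^ n) + z ^ N * (R /ₘ X ^ N).eval z := by
  have hmonic : (X ^ N : ℂ[X]).Monic := monic_X_pow N
  have hsplit : R %ₘ X ^ N + X ^ N * (R /ₘ X ^ N) = R := modByMonic_add_div R (X ^ N)
  have hdeg : (R %ₘ X ^ N).degree < N := by
    have := degree_modByMonic_lt R hmonic
    rwa [degree_X_pow] at this
  have hcoeff : ∀ n < N, (R %ₘ X ^ N).coeff n = R.coeff n := by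
    intro n hn
    conv_rhs => rw [← hsplit]
    rw [coeff_add, coeff_X_pow_mul', if_neg (by omega), add_zero]
  have heval : (R %ₘ X ^ N).eval z = ∑ n ∈ range N, R.coeff n * z ^ n := by
    rcases Nat.eq_zero_or_pos N with hN | hN
    · subst hN
      have : R %ₘ X ^ 0 = 0 := by
        rw [pow_zero]; exact modByMonic_one R
      rw [this]; simp
    · have hnat : (R %ₘ X ^ N).natDegree < N := by
        by_cases h0 : R %ₘ X ^ N = 0
        · rw [h0, natDegree_zero]; exact hN
        · exact (natDegree_lt_iff_degree_lt h0).mpr hdeg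
      rw [eval_eq_sum_range' hnat]
      exact Finset.sum_congr rfl (fun n hn => by rw [hcoeff n (Finset.mem_range.mp hn)])
  conv_lhs => rw [← hsplit]
  rw [eval_add, eval_mul, eval_pow, eval_X, heval]

/-- **Product rule for Taylor coefficients** (Cauchy product). -/
theorem jetCoeff_mul {r : ℝ} (hr : 0 < r) {F G : ℂ → ℂ} (hF : DifferentiableOn ℂ F (ball 0 r))
    (hG : DifferentiableOn ℂ G (ball 0 r)) (n : ℕ) :
    jetCoeff (fun z => F z * G z) n =
      ∑ ij ∈ antidiagonal n, jetCoeff F ij.1 * jetCoeff G ij.2 := by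
  set N := n + 1 with hN
  set R : ℂ[X] := jetPoly F N * jetPoly G N with hR
  have hRcoeff : ∀ m < N, R.coeff m = ∑ ij ∈ antidiagonal m, jetCoeff F ij.1 * jetCoeff G ij.2 := by
    intro m hm
    rw [hR, coeff_mul]
    apply Finset.sum_congr rfl
    intro ij hij
    have h : ij.1 + ij.2 = m := by simpa using hij
    rw [coeff_jetPoly, coeff_jetPoly, if_pos (by omega), if_pos (by omega)]
  -- the remainder
  set ψ := jetTail F N
  set χ := jetTail G N
  set Θ : ℂ → ℂ := fun z => (R /ₘ X ^ N).eval z + (jetPoly F N).eval z * χ z +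
    ψ z * (jetPoly G N).eval z + z ^ N * (ψ z * χ z) with hΘ
  have hΘc : ContinuousAt Θ 0 := by
    have h1 : ContinuousAt ψ 0 := continuousAt_jetTail hr hF N
    have h2 : ContinuousAt χ 0 := continuousAt_jetTail hr hG N
    have h3 : ContinuousAt (fun z => (R /ₘ X ^ N).eval z) 0 := (Polynomial.continuous _).continuousAt
    have h4 : ContinuousAt (fun z => (jetPoly F N).eval z) 0 := (Polynomial.continuous _).continuousAt
    have h5 : ContinuousAt (fun z => (jetPoly G N).eval z) 0 := (Polynomial.continuous _).continuousAt
    simp only [hΘ]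
    fun_prop
  have hexp : ∀ z ∈ ball (0 : ℂ) r, F z * G z = (∑ m ∈ range N, R.coeff m * z ^ m) + z ^ N * Θ z := by
    intro z _
    have eF := jet_eq F N z
    have eG := jet_eq G N z
    rw [← eval_jetPoly] at eF eG
    have eR : (jetPoly F N).eval z * (jetPoly G N).eval z = R.eval z := by rw [hR, eval_mul]
    rw [eF, eG]
    have := eval_eq_sum_range_add_pow_mul R N z
    simp only [hΘ]
    linear_combination eR + this
  have h := jetCoeff_unique' hr (F := fun z => F z * G z) (hF.mul hG) hΘc hexp n (by omega)
  rw [h, hRcoeff n (by omega)]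

/-- Product with a fixed power of `z`: shifts the coefficients. -/
theorem jetCoeff_pow_mul {r : ℝ} (hr : 0 < r) {F : ℂ → ℂ} (hF : DifferentiableOn ℂ F (ball 0 r))
    (k n : ℕ) : jetCoeff (fun z => z ^ k * F z) (n + k) = jetCoeff F n := by
  have hψ : ContinuousAt (jetTail F (n + 1)) 0 := continuousAt_jetTail hr hF _
  have hd : DifferentiableOn ℂ (fun z => z ^ k * F z) (ball 0 r) := by
    exact (differentiableOn_id.pow k).mul hF
  refine jetCoeff_unique' (N := n + k + 1) (c := fun m => if k ≤ m then jetCoeff F (m - k) else 0)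
    hr hd hψ ?_ (n + k) (by omega) |>.trans (by simp)
  intro z _
  rw [jet_eq F (n + 1) z, mul_add, Finset.mul_sum]
  have hsplit : ∑ m ∈ range (n + k + 1), (if k ≤ m then jetCoeff F (m - k) else 0) * z ^ m =
      ∑ m ∈ range (n + 1), z ^ k * (jetCoeff F m * z ^ m) := by
    have : range (n + k + 1) = range k ∪ Finset.image (fun m => m + k) (range (n + 1)) := by
      ext m
      simp only [Finset.mem_union, Finset.mem_range, Finset.mem_image]
      constructor
      · intro hm
        by_cases hmk : m < k
        · exact Or.inl hmk
        · exact Or.inr ⟨m - k, by omega, by omega⟩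
      · rintro (hm | ⟨a, ha, rfl⟩) <;> omega
    rw [this, Finset.sum_union]
    · rw [Finset.sum_eq_zero (fun m hm => by
        rw [if_neg (by have := Finset.mem_range.mp hm; omega), zero_mul])]
      rw [zero_add, Finset.sum_image (fun a _ b _ h => by omega)]
      apply Finset.sum_congr rfl
      intro m _
      rw [if_pos (by omega), Nat.add_sub_cancel, pow_add]; ring
    · rw [Finset.disjoint_left]
      intro m hm hm'
      simp only [Finset.mem_range, Finset.mem_image] at hm hm'
      obtain ⟨a, _, ha⟩ := hm'
      omega
  rw [hsplit]; ring

/-! ### Rotations and rotation averages -/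

/-- `z ↦ F(ω z)` is holomorphic on the disc when `‖ω‖ = 1`. -/
theorem differentiableOn_comp_mul_left {F : ℂ → ℂ} {ω : ℂ} (hω : ‖ω‖ = 1) {r : ℝ}
    (hF : DifferentiableOn ℂ F (ball 0 r)) : DifferentiableOn ℂ (fun z => F (ω * z)) (ball 0 r) := by
  have hmul : DifferentiableOn ℂ (fun z : ℂ => ω * z) (ball 0 r) := by fun_prop
  refine hF.comp hmul ?_
  intro z hz
  simp only [mem_ball, dist_zero_right] at hz ⊢
  rw [norm_mul, hω, one_mul]; exact hz

/-- Coefficients of `z ↦ F(ω z)` for `‖ω‖ = 1`: `ωⁿ · jetCoeff F n`. -/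
theorem jetCoeff_comp_mul_left {r : ℝ} (hr : 0 < r) {F : ℂ → ℂ} (hF : DifferentiableOn ℂ F (ball 0 r))
    {ω : ℂ} (hω : ‖ω‖ = 1) (n : ℕ) : jetCoeff (fun z => F (ω * z)) n = ω ^ n * jetCoeff F n := by
  have hψ : ContinuousAt (fun z => ω ^ (n + 1) * jetTail F (n + 1) (ω * z)) 0 := by
    have h1 : ContinuousAt (jetTail F (n + 1)) (ω * 0) := by
      rw [mul_zero]; exact continuousAt_jetTail hr hF _
    have h2 : ContinuousAt (fun z : ℂ => ω * z) 0 := by fun_prop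
    exact continuousAt_const.mul (ContinuousAt.comp (g := jetTail F (n + 1)) h1 h2)
  refine jetCoeff_unique' (N := n + 1) (c := fun m => ω ^ m * jetCoeff F m) hr
    (differentiableOn_comp_mul_left hω hF) hψ ?_ n (Nat.lt_add_one n)
  intro z _
  rw [jet_eq F (n + 1) (ω * z)]
  simp only [mul_pow]
  have : ∀ m ∈ range (n + 1), jetCoeff F m * (ω ^ m * z ^ m) = ω ^ m * jetCoeff F m * z ^ m := by
    intro m _; ring
  rw [Finset.sum_congr rfl this]; ring

/-- Character sums over the `k`-th roots of unity. -/
theorem sum_pow_mul_eq {k : ℕ} {ω : ℂ} (hω : IsPrimitiveRoot ω k) (n : ℕ) :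
    ∑ j ∈ range k, (ω ^ j) ^ n = if k ∣ n then (k : ℂ) else 0 := by
  have h : ∀ j ∈ range k, (ω ^ j) ^ n = (ω ^ n) ^ j := by
    intro j _; rw [← pow_mul, ← pow_mul, mul_comm]
  rw [Finset.sum_congr rfl h]
  split_ifs with hdvd
  · have : ω ^ n = 1 := (hω.pow_eq_one_iff_dvd n).mpr hdvd
    simp [this]
  · have hne : ω ^ n ≠ 1 := fun e => hdvd ((hω.pow_eq_one_iff_dvd n).mp e)
    have hk1 : (ω ^ n) ^ k = 1 := by rw [← pow_mul, mul_comm, pow_mul, hω.pow_eq_one, one_pow]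
    rw [geom_sum_eq hne, hk1, sub_self, zero_div]

/-- **Rotation average.** For `ω` a primitive `k`-th root of unity the function
`z ↦ k⁻¹ Σ_{j<k} F(ωʲ z)` has Taylor coefficients `jetCoeff F n` for `k ∣ n` and `0` otherwise. -/
theorem jetCoeff_rotAvg {r : ℝ} (hr : 0 < r) {F : ℂ → ℂ} (hF : DifferentiableOn ℂ F (ball 0 r))
    {k : ℕ} (hk : 1 ≤ k) {ω : ℂ} (hω : IsPrimitiveRoot ω k) (n : ℕ) :
    jetCoeff (fun z => (k : ℂ)⁻¹ * ∑ j ∈ range k, F (ω ^ j * z)) n =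
      if k ∣ n then jetCoeff F n else 0 := by
  have hω1 : ‖ω‖ = 1 := hω.norm'_eq_one (by omega)
  have hωj : ∀ j : ℕ, ‖ω ^ j‖ = 1 := fun j => by rw [norm_pow, hω1, one_pow]
  have hdj : ∀ j : ℕ, DifferentiableOn ℂ (fun z => F (ω ^ j * z)) (ball 0 r) :=
    fun j => differentiableOn_comp_mul_left (hωj j) hF
  -- coefficients of the sum, by induction over the number of summands via linearity
  have hsum : ∀ (s : Finset ℕ), jetCoeff (fun z => ∑ j ∈ s, F (ω ^ j * z)) n =
      ∑ j ∈ s, (ω ^ j) ^ n * jetCoeff F n := by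
    intro s
    induction s using Finset.induction_on with
    | empty => simp [jetCoeff_const]
    | insert a s ha ih =>
      have hds : DifferentiableOn ℂ (fun z => ∑ j ∈ s, F (ω ^ j * z)) (ball 0 r) :=
        DifferentiableOn.fun_sum (u := s) (fun j _ => hdj j)
      rw [Finset.sum_insert ha]
      have e : (fun z => ∑ j ∈ insert a s, F (ω ^ j * z)) =
          fun z => F (ω ^ a * z) + ∑ j ∈ s, F (ω ^ j * z) := by
        funext z; rw [Finset.sum_insert ha]
      rw [e, jetCoeff_add hr (hdj a) hds, ih, jetCoeff_comp_mul_left hr hF (hωj a)]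
  have hdS : DifferentiableOn ℂ (fun z => ∑ j ∈ range k, F (ω ^ j * z)) (ball 0 r) :=
    DifferentiableOn.fun_sum (u := range k) (fun j _ => hdj j)
  rw [jetCoeff_const_mul hr hdS, hsum, ← Finset.sum_mul, sum_pow_mul_eq hω n]
  have hk0 : (k : ℂ) ≠ 0 := by exact_mod_cast (show k ≠ 0 by omega)
  split_ifs
  · field_simp
  · simp

end

end Summit.Ventures.DiscreteObjects.Mahler
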